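import Mathlib
import HarnessLib
import Summits.ValiantsHypothesis.ValiantsHypothesis.Theorems.BiSetMultilinearPrograms

/-!
# Bi-set-multilinear programs: availability bookkeeping for building programs

Companion of `BiSetMultilinearCounting.lean` / `BiSetMultilinearPrograms.lean` (workshop
`decomp-valiant`, lens 6, generation 25; census cell D3; CALIBRATION only — `VP ≠ VNP` is NOT proved,
LADDER-Valiant rung 0). Those files prove LOWER bounds for bi-set-multilinear straight-line programs
(`Prog`); to prove the matching UPPER bound (`BiSetMultilinearLaplace.lean`: the Laplace / column-subset
DP for `per_n` and `det_n` is such a program of length `≤ 4(n+1)2^n`) one has to BUILD programs, and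
this file is the bookkeeping for that:

* `Prog.gates_append`, `Prog.getElem?_gates`, `Prog.getElem?_gates_concat` — unfolding a concatenation
  unfolds the prefix first and keeps its gates in place; one more instruction appends exactly one gate;
* `Prog.Avail P f R C` — the polynomial `f` is *available* in `P` with label `(R, C)`: some gate of `P`
  unfolds to a well-formed term with rows `R`, columns `C`, computing `f`; `Prog.Avail.mono` —
  availability survives appending instructions; `Prog.Avail.exists_mem` — the output form used by the
  lower bounds (`∃ g ∈ gates [] P, g.WF ∧ …`);
* `Prog.avail_input/const/mul/smul/add` — one instruction extends availability; `mul` needs row- AND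
  column-disjoint labels and yields their unions, `add` needs EQUAL labels (exactly `Term.WF`);
* `Prog.avail_list_sum` — a nonempty list of summands with a common label, each producible by `≤ m`
  instructions on top of any extension, is summed by `≤ |l|(m+1)` instructions; `Prog.iterate` — a work
  list of monotone goals, each reachable by `≤ m` instructions on top of any extension, is reached
  simultaneously by `≤ |L|·m` instructions.

Reference for the model: [JerrumSnir1982] M. Jerrum, M. Snir, J. ACM 29 (1982) 874–897, §3.
-/

noncomputable section

open MvPolynomial Finset

open scoped Nat

-- lint debt (as in every `…ValiantsHypothesis.Theorems.*` file): the mandated namespace repeats a component.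
set_option linter.dupNamespace false

namespace Summit.ValiantsHypothesis.ValiantsHypothesis.Theorems.BiSetMultilinearCounting

open Literature.Computability.AlgebraicComplexity

universe u v

namespace Prog

variable {k : Type u} {ι : Type v}

section Gates

variable [CommRing k]

/-- Unfolding a concatenation: first `P`, then `Q` on top of the gates of `P`. -/
theorem gates_append : ∀ (acc : List (Term k ι)) (P Q : Prog k ι),
    gates acc (P ++ Q) = gates (gates acc P) Q
  | acc, [], Q => by simp [gates]
  | acc, ins :: P, Q => by
      rw [List.cons_append, gates, gates, gates_append]

/-- Unfolding one more instruction appends exactly one term. -/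
theorem gates_concat (acc : List (Term k ι)) (P : Prog k ι) (ins : Instr k ι) :
    gates acc (P ++ [ins]) = gates acc P ++ [build (gates acc P) ins] := by
  rw [gates_append]; simp [gates]

/-- The unfolded earlier gates are a prefix of the unfolding. -/
theorem gates_eq_append : ∀ (acc : List (Term k ι)) (P : Prog k ι),
    ∃ L : List (Term k ι), gates acc P = acc ++ L
  | acc, [] => ⟨[], by simp [gates]⟩
  | acc, ins :: P => by
      obtain ⟨L, hL⟩ := gates_eq_append (acc ++ [build acc ins]) P
      exact ⟨build acc ins :: L, by rw [gates, hL]; simp⟩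

/-- Earlier gates keep their positions. -/
theorem getElem?_gates {acc : List (Term k ι)} (P : Prog k ι) {i : ℕ} (hi : i < acc.length) :
    (gates acc P)[i]? = acc[i]? := by
  obtain ⟨L, hL⟩ := gates_eq_append acc P
  rw [hL, List.getElem?_append_left hi]

/-- A gate present at position `i` is what `fetch` returns. -/
theorem fetch_eq_of_getElem? {acc : List (Term k ι)} {i : ℕ} {g : Term k ι} (h : acc[i]? = some g) :
    fetch acc i = g := by
  unfold fetch; rw [h]; rfl

end Gates

variable [DecidableEq ι] [CommRing k]

/-- AVAILABILITY: some gate of the program `P` unfolds to a well-formed term with label `(R, C)`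
computing `f`. -/
def Avail (P : Prog k ι) (f : MvPolynomial (ι × ι) k) (R C : Finset ι) : Prop :=
  ∃ (i : ℕ) (g : Term k ι),
    (gates [] P)[i]? = some g ∧ g.WF ∧ g.rows = R ∧ g.cols = C ∧ g.eval = f

/-- Availability survives appending instructions. -/
theorem Avail.mono {P : Prog k ι} {f : MvPolynomial (ι × ι) k} {R C : Finset ι} (h : Avail P f R C)
    (Q : Prog k ι) : Avail (P ++ Q) f R C := by
  obtain ⟨i, g, hg, hwf, hr, hc, he⟩ := h
  refine ⟨i, g, ?_, hwf, hr, hc, he⟩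
  rw [gates_append, getElem?_gates Q (List.getElem?_eq_some_iff.1 hg).1, hg]

/-- Availability along a prefix. -/
theorem Avail.of_prefix {P P' : Prog k ι} {f : MvPolynomial (ι × ι) k} {R C : Finset ι}
    (h : Avail P f R C) (hP : P <+: P') : Avail P' f R C := by
  obtain ⟨Q, rfl⟩ := hP; exact h.mono Q

/-- An available gate is a member of the unfolding. -/
theorem Avail.exists_mem {P : Prog k ι} {f : MvPolynomial (ι × ι) k} {R C : Finset ι}
    (h : Avail P f R C) :
    ∃ g ∈ gates [] P, g.WF ∧ g.rows = R ∧ g.cols = C ∧ g.eval = f := by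
  obtain ⟨i, g, hg, hwf, hr, hc, he⟩ := h
  exact ⟨g, List.mem_of_getElem? hg, hwf, hr, hc, he⟩

omit [DecidableEq ι] in
/-- The gate appended by one more instruction sits at the end of the unfolding. -/
theorem getElem?_gates_concat (P : Prog k ι) (ins : Instr k ι) :
    (gates [] (P ++ [ins]))[(gates [] P).length]? = some (build (gates [] P) ins) := by
  rw [gates_concat]; simp

/-- One `input` instruction makes `x_{(r,c)}` available with label `({r},{c})`. -/
theorem avail_input (P : Prog k ι) (r c : ι) :
    Avail (P ++ [Instr.input r c]) (X (r, c)) {r} {c} :=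
  ⟨_, _, getElem?_gates_concat P _, by simp [build, Term.WF], by simp [build, Term.rows],
    by simp [build, Term.cols], by simp [build, Term.eval]⟩

/-- One `const` instruction makes `C a` available with label `(∅,∅)`. -/
theorem avail_const (P : Prog k ι) (a : k) :
    Avail (P ++ [Instr.const a]) (C a) ∅ ∅ :=
  ⟨_, _, getElem?_gates_concat P _, by simp [build, Term.WF], by simp [build, Term.rows],
    by simp [build, Term.cols], by simp [build, Term.eval]⟩

/-- One `mul` instruction multiplies two available polynomials with row-disjoint and column-disjoint
labels; the label of the product is the union. -/
theorem avail_mul {P : Prog k ι} {f₁ f₂ : MvPolynomial (ι × ι) k} {R₁ C₁ R₂ C₂ : Finset ι}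
    (h₁ : Avail P f₁ R₁ C₁) (h₂ : Avail P f₂ R₂ C₂) (hR : Disjoint R₁ R₂)
    (hC : Disjoint C₁ C₂) :
    ∃ ins : Instr k ι, Avail (P ++ [ins]) (f₁ * f₂) (R₁ ∪ R₂) (C₁ ∪ C₂) := by
  obtain ⟨i, g₁, hg₁, hwf₁, hr₁, hc₁, he₁⟩ := h₁
  obtain ⟨j, g₂, hg₂, hwf₂, hr₂, hc₂, he₂⟩ := h₂
  refine ⟨Instr.mul i j, _, _, getElem?_gates_concat P _, ?_, ?_, ?_, ?_⟩
  all_goals simp only [build, fetch_eq_of_getElem? hg₁, fetch_eq_of_getElem? hg₂]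
  · exact ⟨hwf₁, hwf₂, by rwa [hr₁, hr₂], by rwa [hc₁, hc₂]⟩
  · simp [Term.rows, hr₁, hr₂]
  · simp [Term.cols, hc₁, hc₂]
  · simp [Term.eval, he₁, he₂]

/-- One `smul` instruction rescales an available polynomial, label unchanged. -/
theorem avail_smul {P : Prog k ι} {f : MvPolynomial (ι × ι) k} {R C : Finset ι}
    (h : Avail P f R C) (a : k) : ∃ ins : Instr k ι, Avail (P ++ [ins]) (a • f) R C := by
  obtain ⟨i, g, hg, hwf, hr, hc, he⟩ := h
  refine ⟨Instr.smul a i, _, _, getElem?_gates_concat P _, ?_, ?_, ?_, ?_⟩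
  all_goals simp only [build, fetch_eq_of_getElem? hg]
  · simpa [Term.WF] using hwf
  · simp [Term.rows, hr]
  · simp [Term.cols, hc]
  · simp [Term.eval, he]

/-- One `add` instruction adds two available polynomials with EQUAL labels. -/
theorem avail_add {P : Prog k ι} {f₁ f₂ : MvPolynomial (ι × ι) k} {R C : Finset ι}
    (h₁ : Avail P f₁ R C) (h₂ : Avail P f₂ R C) :
    ∃ ins : Instr k ι, Avail (P ++ [ins]) (f₁ + f₂) R C := by
  obtain ⟨i, g₁, hg₁, hwf₁, hr₁, hc₁, he₁⟩ := h₁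
  obtain ⟨j, g₂, hg₂, hwf₂, hr₂, hc₂, he₂⟩ := h₂
  refine ⟨Instr.add i j, _, _, getElem?_gates_concat P _, ?_, ?_, ?_, ?_⟩
  all_goals simp only [build, fetch_eq_of_getElem? hg₁, fetch_eq_of_getElem? hg₂]
  · exact ⟨hwf₁, hwf₂, by rw [hr₁, hr₂], by rw [hc₁, hc₂]⟩
  · simp [Term.rows, hr₁]
  · simp [Term.cols, hc₁]
  · simp [Term.eval, he₁, he₂]

/-! ### Sums of producible terms and iteration over a work list -/

/-- Summing a NONEMPTY list of producible polynomials with a common label `(R, C)`: if each summand can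
be produced by `≤ m` instructions on top of any extension of `P`, then `≤ |l|·(m+1)` instructions on top
of `P` make the sum available with the same label. -/
theorem avail_list_sum {α : Type*} (t : α → MvPolynomial (ι × ι) k) (R C : Finset ι) (m : ℕ) :
    ∀ (l : List α), l ≠ [] → ∀ P : Prog k ι,
      (∀ a ∈ l, ∀ P' : Prog k ι, P <+: P' →
        ∃ Q : Prog k ι, Q.length ≤ m ∧ Avail (P' ++ Q) (t a) R C) →
      ∃ Q : Prog k ι, Q.length ≤ l.length * (m + 1) ∧ Avail (P ++ Q) (l.map t).sum R C
  | [], h, _, _ => absurd rfl h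
  | [a], _, P, hprod => by
      obtain ⟨Q, hQ, hav⟩ := hprod a (by simp) P (List.prefix_refl P)
      exact ⟨Q, by simp only [List.length_singleton]; omega, by simpa using hav⟩
  | a :: b :: l, _, P, hprod => by
      obtain ⟨Q₁, hQ₁, hav₁⟩ := hprod a (by simp) P (List.prefix_refl P)
      obtain ⟨Q₂, hQ₂, hav₂⟩ := avail_list_sum t R C m (b :: l) (by simp) (P ++ Q₁)
        (fun x hx P' hP' => hprod x (by simp only [List.mem_cons] at hx ⊢; exact Or.inr hx) P'
          ((List.prefix_append P Q₁).trans hP'))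
      obtain ⟨ins, hav⟩ := avail_add (hav₁.mono Q₂) hav₂
      refine ⟨Q₁ ++ Q₂ ++ [ins], ?_, ?_⟩
      · have h : (a :: b :: l).length * (m + 1) = (b :: l).length * (m + 1) + (m + 1) := by
          simp only [List.length_cons]; ring
        simp only [List.length_append, List.length_singleton]
        omega
      · simpa [List.append_assoc] using hav

omit [DecidableEq ι] [CommRing k] in
/-- Iterating producers over a work list: if, for every `b ∈ L`, `≤ m` instructions on top of any
extension of `P` establish the monotone property `Good b`, then `≤ |L|·m` instructions on top of `P`
establish `Good b` for all `b ∈ L` simultaneously. -/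
theorem iterate {β : Type*} (Good : β → Prog k ι → Prop)
    (hmono : ∀ b (P Q : Prog k ι), Good b P → Good b (P ++ Q)) (m : ℕ) :
    ∀ (L : List β) (P : Prog k ι),
      (∀ b ∈ L, ∀ P' : Prog k ι, P <+: P' →
        ∃ Q : Prog k ι, Q.length ≤ m ∧ Good b (P' ++ Q)) →
      ∃ Q : Prog k ι, Q.length ≤ L.length * m ∧ ∀ b ∈ L, Good b (P ++ Q)
  | [], _, _ => ⟨[], by simp, by simp⟩
  | b :: L, P, hprod => by
      obtain ⟨Q₁, hQ₁, hb⟩ := hprod b (by simp) P (List.prefix_refl P)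
      obtain ⟨Q₂, hQ₂, hL⟩ := iterate Good hmono m L (P ++ Q₁)
        (fun x hx P' hP' => hprod x (by simp only [List.mem_cons]; exact Or.inr hx) P'
          ((List.prefix_append P Q₁).trans hP'))
      refine ⟨Q₁ ++ Q₂, ?_, ?_⟩
      · have h : (b :: L).length * m = L.length * m + m := by
          simp only [List.length_cons]; ring
        simp only [List.length_append]
        omega
      · intro x hx
        rcases List.mem_cons.1 hx with rfl | hx
        · simpa [List.append_assoc] using hmono _ _ Q₂ hb
        · simpa [List.append_assoc] using hL x hx

end Prog

end Summit.ValiantsHypothesis.ValiantsHypothesis.Theorems.BiSetMultilinearCounting
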